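import Mathlib
import HarnessLib
import Summits.Ventures.LatticeQCDFlow.Scoring.IMHAcceptanceRecord
import Summits.Ventures.LatticeQCDFlow.Scoring.DoeblinAutocorrelation
import Summits.Ventures.LatticeQCDFlow.Exactness.ApproxTrivializingSampler

/-!
# The acceptance record of the exact flow-MCMC chain, II: the Doeblin envelope

HONEST FRAMING: exact (Metropolis-corrected) sampling algorithms for lattice gauge theory;
figures of merit are autocorrelation/cost numbers at stated couplings and volumes; no
continuum-physics claim.

Venture `LatticeQCDFlow` (cell pub-lqcd), topic `Scoring`; flow / samplers seat (GEN-36).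
NEW WORK of the cell, not a published result; nothing here is cited as a fact.  Printed
counterparts NAMED ONLY: Liu 1996 / Mengersen–Tweedie 1996 (the independence sampler is uniformly
ergodic iff the weight is bounded, rate `1 − 1/M`), Bhatia–Davis 2000 (variance of a bounded
random variable).  Pure measure theory over the tree: `Scoring/IMHAcceptanceRecord.lean` (the
record chain, THE RECORD LAW `C_A(t+1) = C_α(t)`, `variance_sum_acceptFlag`, the LOWER half
`Var[Σ A_i] ≥ N ā(1 − ā)`), row 8's Doeblin envelope `abs_autocov_le_of_doeblin`, row 30's
`indepMH_apply_ge` / `imhAcceptE_ge_of_le`, and `Exactness.flowSampler_exact_doeblin`.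
That file listed the UPPER envelope as not claimed; this file supplies it.  No number from any
run enters, and nothing here decides between samplers.

Setting (as there): MODEL `q`, TARGET `π = w · q` a probability law, `w > 0` measurable,
`K = indepMH q w`, `α(x) = (imhAcceptMass q w x).toReal` the local acceptance rate, `ā = ∫ α dπ`,
`V_α = ∫ (α − ā)² dπ`, `C_α(t) = autocov K π (α − ā) t`, flags `A_i`, path law `imhRecordPath`.
A Doeblin constant is an `ε` with `K(x, ·) ≥ ε π`; write `e = ε.toReal`.
* `autocov_acceptRate_le_of_doeblin`: `C_α(t) ≤ (1 − e)ᵗ V_α`.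
* **`variance_sum_acceptFlag_le_of_doeblin`** (THE ENVELOPE OF THE RECORD): for every `N`,
  `Var[Σ_{i<N} A_i] ≤ N ā(1 − ā) + (2N/e) V_α` (record law + envelope + `Σ_{t<N} (1 − e)ᵗ ≤ 1/e`).
* `IMHAcceptanceRecordEnvelope.integral_sq_sub_le_of_mem_Icc` (Bhatia–Davis on `[e, 1]`):
  `∫ (g − ḡ)² dμ ≤ (ḡ − e)(1 − ḡ)`; `inv_le_imhAcceptMass_of_le`: under `0 < w ≤ M` the chain
  accepts from EVERY state with probability `≥ 1/M`.
* `variance_sum_acceptFlag_le_of_floor`: with a pointwise acceptance floor `α ≥ ε`,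
  `Var[Σ_{i<N} A_i] ≤ N ā(1 − ā) + 2N (1 − ā)(ā − e)/e`.
* **`variance_sum_acceptFlag_sandwich_of_le`** (THE DISPERSION SANDWICH): under `0 < w ≤ M`,
  `N ā(1 − ā) ≤ Var[Σ_{i<N} A_i] ≤ (1 + 2(M − 1/ā)) · N ā(1 − ā)` for every `N` — the
  dispersion index of the acceptance count against `N` independent coin flips at the chain's own
  acceptance rate lies in `[1, 1 + 2(M − 1/ā)] ⊆ [1, 2M − 1]`, uniformly in `N` and the volume.
* **`flowSampler_acceptRecord_sandwich`** (lattice instance): for an exact flow sampler on an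
  approximately trivializing flow with Lüscher defect `≤ δ` (`M = e^{2δ}`), the index lies in
  `[1, 1 + 2(e^{2δ} − 1/ā)]` and `ā ≥ e^{−2δ}`.
Why not the generic `variance_timeAverage_le_of_doeblin` (factor `2/e − 1 = 1 + 2(1/e − 1)`): the
flag is not a function of the state, and the record kernel `K̂((x, b), ·)` is not minorised by its
invariant law `π̂` in one step (it cannot reach `{(x', reject) : x' ≠ x}`); the bound goes through
the record law, and centring at the flags' own mean is what turns `1/e − 1` into `1/e − 1/ā`.
NOT CLAIMED: any number of ours; non-stationary starts; a CLT for the count; sharpness of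
`2(M − 1/ā)` (both sides of the sandwich coincide, and vanish, at `w ≡ 1`).
-/

noncomputable section
namespace Summit.Ventures.LatticeQCDFlow.Scoring
open MeasureTheory ProbabilityTheory Filter Finset Summit.Ventures.LatticeQCDFlow.Exactness
open scoped ENNReal

section General

variable {Ω : Type*} [MeasurableSpace Ω]

/-! ### Two scalar lemmas (file-local namespace) -/

namespace IMHAcceptanceRecordEnvelope

/-- The geometric series of the envelope: `Σ_{t<N} (1 − e)ᵗ ≤ 1/e` for `0 < e ≤ 1`. -/
theorem sum_range_pow_one_sub_le {e : ℝ} (he0 : 0 < e) (he1 : e ≤ 1) (N : ℕ) :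
    ∑ t ∈ range N, (1 - e) ^ t ≤ 1 / e := by
  rw [le_div_iff₀ he0]
  have h : (∑ t ∈ range N, (1 - e) ^ t) * e = 1 - (1 - e) ^ N := by
    have := geom_sum_mul_neg (1 - e) N
    rwa [sub_sub_cancel] at this
  rw [h]
  linarith [pow_nonneg (sub_nonneg.2 he1) N]

/-- **Bhatia–Davis on `[e, 1]`**: for a measurable `g` with `e ≤ g ≤ 1` under a probability law
`μ`, `∫ (g − ḡ)² dμ ≤ (ḡ − e)(1 − ḡ)` with `ḡ = ∫ g dμ` (integrate `(1 − g)(g − e) ≥ 0`). -/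
theorem integral_sq_sub_le_of_mem_Icc (μ : Measure Ω) [IsProbabilityMeasure μ] {g : Ω → ℝ}
    (hg : Measurable g) {e : ℝ} (hge : ∀ x, e ≤ g x) (hg1 : ∀ x, g x ≤ 1) :
    ∫ x, (g x - ∫ y, g y ∂μ) ^ 2 ∂μ ≤ ((∫ y, g y ∂μ) - e) * (1 - ∫ y, g y ∂μ) := by
  set m := ∫ y, g y ∂μ with hm
  have hgb : ∀ x, |g x| ≤ max |e| 1 := fun x =>
    abs_le.2 ⟨by linarith [neg_abs_le e, le_max_left |e| 1, hge x],
      (hg1 x).trans (le_max_right _ _)⟩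
  have hI : Integrable g μ := integrable_of_bounded μ hg hgb
  have hpt : ∀ x, (g x - m) ^ 2 ≤ (1 + e - 2 * m) * g x + (m ^ 2 - e) := fun x => by
    nlinarith [mul_nonneg (sub_nonneg.2 (hg1 x)) (sub_nonneg.2 (hge x))]
  have hL : Integrable (fun x => (g x - m) ^ 2) μ :=
    integrable_of_bounded μ ((hg.sub measurable_const).pow_const 2) (C := (max |e| 1 + |m|) ^ 2)
      fun x => by
        rw [abs_pow]
        exact pow_le_pow_left₀ (abs_nonneg _) ((abs_sub _ _).trans (add_le_add (hgb x) le_rfl)) 2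
  have hR : Integrable (fun x => (1 + e - 2 * m) * g x + (m ^ 2 - e)) μ :=
    (hI.const_mul _).add (integrable_const _)
  calc ∫ x, (g x - m) ^ 2 ∂μ ≤ ∫ x, ((1 + e - 2 * m) * g x + (m ^ 2 - e)) ∂μ :=
        integral_mono hL hR hpt
    _ = (1 + e - 2 * m) * m + (m ^ 2 - e) := by
        rw [integral_add (hI.const_mul _) (integrable_const _), integral_const_mul, integral_const,
          probReal_univ, one_smul]
    _ = (m - e) * (1 - m) := by ring

end IMHAcceptanceRecordEnvelope

open IMHAcceptanceRecordEnvelope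

/-! ### The envelope of the acceptance record -/

variable {q : Measure Ω} [IsProbabilityMeasure q] {w : Ω → ℝ} {π : Measure Ω}

omit [IsProbabilityMeasure q] in
/-- **Acceptance floor under a weight bound**: if `0 < w ≤ M` and `π = w · q` is a probability
law, the flow-MCMC chain accepts from EVERY state with probability at least `1/M`
(`imhAcceptE_ge_of_le`, integrated against the model `q`). -/
theorem inv_le_imhAcceptMass_of_le (hw : Measurable w) (hw0 : ∀ x, 0 < w x) {M : ℝ}
    (hM : ∀ x, w x ≤ M) [IsProbabilityMeasure π]
    (hπ : (q.withDensity fun x => ENNReal.ofReal (w x)) = π) (x : Ω) :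
    (ENNReal.ofReal M)⁻¹ ≤ imhAcceptMass q w x := by
  have hMpos : 0 < M := (hw0 x).trans_le (hM x)
  have huniv : ∫⁻ y, ENNReal.ofReal (w y) ∂q = 1 := by
    have h := withDensity_apply (fun y => ENNReal.ofReal (w y)) (μ := q) MeasurableSet.univ
    rw [hπ, measure_univ, Measure.restrict_univ] at h
    exact h.symm
  unfold imhAcceptMass
  calc (ENNReal.ofReal M)⁻¹ = (ENNReal.ofReal M)⁻¹ * ∫⁻ y, ENNReal.ofReal (w y) ∂q := by
        rw [huniv, mul_one]
    _ = ∫⁻ y, (ENNReal.ofReal M)⁻¹ * ENNReal.ofReal (w y) ∂q :=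
        (lintegral_const_mul _ hw.ennreal_ofReal).symm
    _ = ∫⁻ y, ENNReal.ofReal (w y / M) ∂q := by
        refine lintegral_congr fun y => ?_
        rw [div_eq_inv_mul, ENNReal.ofReal_mul (inv_nonneg.2 hMpos.le),
          ENNReal.ofReal_inv_of_pos hMpos]
    _ ≤ ∫⁻ y, imhAcceptE w x y ∂q := lintegral_mono fun y => imhAcceptE_ge_of_le hw0 hM x y

/-- **Envelope of the acceptance-rate autocovariance**: under `K(x, ·) ≥ ε π`,
`C_α(t) ≤ (1 − ε)ᵗ V_α` at every lag (`abs_autocov_le_of_doeblin` on the centred rate). -/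
theorem autocov_acceptRate_le_of_doeblin (hw : Measurable w) (hw0 : ∀ x, 0 < w x)
    [IsProbabilityMeasure π] (hπ : (q.withDensity fun x => ENNReal.ofReal (w x)) = π)
    {ε : ℝ≥0∞} (hmin : ∀ x {B : Set Ω}, MeasurableSet B → ε * π B ≤ indepMH q w x B) (t : ℕ) :
    autocov (indepMH q w) π
        (fun x => (imhAcceptMass q w x).toReal - ∫ x, (imhAcceptMass q w x).toReal ∂π) t
      ≤ (1 - ε.toReal) ^ t *
        ∫ x, ((imhAcceptMass q w x).toReal - ∫ y, (imhAcceptMass q w y).toReal ∂π) ^ 2 ∂π := by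
  haveI : Fact (Measurable w) := ⟨hw⟩
  have hinv : Kernel.Invariant (indepMH q w) π := hπ ▸ indepMH_invariant hw hw0
  have hf0 : ∫ x, ((imhAcceptMass q w x).toReal - ∫ y, (imhAcceptMass q w y).toReal ∂π) ∂π = 0 := by
    rw [integral_sub (integrable_of_bounded π (measurable_toReal_imhAcceptMass (q := q) hw)
      abs_toReal_imhAcceptMass_le) (integrable_const _), integral_const, probReal_univ, one_smul,
      sub_self]
  exact (le_abs_self _).trans (abs_autocov_le_of_doeblin hinv hmin
    ((measurable_toReal_imhAcceptMass (q := q) hw).sub measurable_const)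
    (C := 1 + |∫ y, (imhAcceptMass q w y).toReal ∂π|)
    (fun x => (abs_sub _ _).trans (add_le_add (abs_toReal_imhAcceptMass_le x) le_rfl)) hf0 t)

section Path

variable [Fact (Measurable w)] [IsProbabilityMeasure π]

/-- **THE ENVELOPE OF THE ACCEPTANCE RECORD**: under `K(x, ·) ≥ ε π` with `ε > 0`, for the
record chain started in `π̂` and every `N`, `Var[Σ_{i<N} A_i] ≤ N ā(1 − ā) + (2N/ε) V_α`. -/
theorem variance_sum_acceptFlag_le_of_doeblin (hw0 : ∀ x, 0 < w x)
    (hπ : (q.withDensity fun x => ENNReal.ofReal (w x)) = π) {ε : ℝ≥0∞}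
    (hmin : ∀ x {B : Set Ω}, MeasurableSet B → ε * π B ≤ indepMH q w x B) (hε0 : 0 < ε) (N : ℕ) :
    Var[fun x : ℕ → Ω × Bool => ∑ i ∈ range N, acceptFlag (x i); imhRecordPath q w π]
      ≤ N * ((∫ x, (imhAcceptMass q w x).toReal ∂π) * (1 - ∫ x, (imhAcceptMass q w x).toReal ∂π))
        + 2 * N / ε.toReal *
          ∫ x, ((imhAcceptMass q w x).toReal - ∫ y, (imhAcceptMass q w y).toReal ∂π) ^ 2 ∂π := by
  have hw : Measurable w := Fact.out
  have hinv : Kernel.Invariant (indepMH q w) π := hπ ▸ indepMH_invariant hw hw0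
  rw [variance_sum_acceptFlag hw0 hinv N]
  set V := ∫ x, ((imhAcceptMass q w x).toReal - ∫ y, (imhAcceptMass q w y).toReal ∂π) ^ 2 ∂π
    with hV
  have hV0 : 0 ≤ V := integral_nonneg fun x => sq_nonneg _
  have hε1 := eps_le_one_of_doeblin hmin
  have he0 : 0 < ε.toReal :=
    ENNReal.toReal_pos hε0.ne' (ne_top_of_le_ne_top ENNReal.one_ne_top hε1)
  have he1 : ε.toReal ≤ 1 := by
    have h := ENNReal.toReal_mono ENNReal.one_ne_top hε1
    rwa [ENNReal.toReal_one] at h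
  have hN0 : (0 : ℝ) ≤ N := Nat.cast_nonneg N
  have hterm : ∀ t ∈ range N,
      ((N : ℝ) - (t + 1)) * autocov (indepMH q w) π
          (fun x => (imhAcceptMass q w x).toReal - ∫ x, (imhAcceptMass q w x).toReal ∂π) t
        ≤ N * ((1 - ε.toReal) ^ t * V) := fun t ht => by
    have ht' : (t : ℝ) + 1 ≤ N := by exact_mod_cast mem_range.1 ht
    have henv := autocov_acceptRate_le_of_doeblin hw hw0 hπ hmin t
    have hgV : 0 ≤ (1 - ε.toReal) ^ t * V := mul_nonneg (pow_nonneg (by linarith) t) hV0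
    calc ((N : ℝ) - (t + 1)) * autocov (indepMH q w) π
            (fun x => (imhAcceptMass q w x).toReal - ∫ x, (imhAcceptMass q w x).toReal ∂π) t
          ≤ ((N : ℝ) - (t + 1)) * ((1 - ε.toReal) ^ t * V) :=
          mul_le_mul_of_nonneg_left henv (by linarith)
      _ ≤ N * ((1 - ε.toReal) ^ t * V) := mul_le_mul_of_nonneg_right (by linarith) hgV
  have hsum : ∑ t ∈ range N, ((N : ℝ) - (t + 1)) * autocov (indepMH q w) π
        (fun x => (imhAcceptMass q w x).toReal - ∫ x, (imhAcceptMass q w x).toReal ∂π) t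
      ≤ N * (V / ε.toReal) := by
    refine (sum_le_sum hterm).trans ?_
    rw [← mul_sum, ← sum_mul]
    refine mul_le_mul_of_nonneg_left ?_ hN0
    calc (∑ t ∈ range N, (1 - ε.toReal) ^ t) * V ≤ 1 / ε.toReal * V :=
          mul_le_mul_of_nonneg_right (sum_range_pow_one_sub_le he0 he1 N) hV0
      _ = V / ε.toReal := by rw [one_div, inv_mul_eq_div]
  have h2 : 2 * (N * (V / ε.toReal)) = 2 * N / ε.toReal * V := by ring
  linarith

/-- **With an acceptance floor** `α ≥ ε` pointwise (which every exact flow sampler with a bounded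
weight has, `inv_le_imhAcceptMass_of_le`): `Var[Σ_{i<N} A_i] ≤ N ā(1 − ā) + 2N(1 − ā)(ā − ε)/ε`
(the envelope, then Bhatia–Davis `V_α ≤ (ā − ε)(1 − ā)`). -/
theorem variance_sum_acceptFlag_le_of_floor (hw0 : ∀ x, 0 < w x)
    (hπ : (q.withDensity fun x => ENNReal.ofReal (w x)) = π) {ε : ℝ≥0∞}
    (hmin : ∀ x {B : Set Ω}, MeasurableSet B → ε * π B ≤ indepMH q w x B) (hε0 : 0 < ε)
    (hacc : ∀ x, ε ≤ imhAcceptMass q w x) (N : ℕ) :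
    Var[fun x : ℕ → Ω × Bool => ∑ i ∈ range N, acceptFlag (x i); imhRecordPath q w π]
      ≤ N * ((∫ x, (imhAcceptMass q w x).toReal ∂π) * (1 - ∫ x, (imhAcceptMass q w x).toReal ∂π))
        + 2 * N * ((1 - ∫ x, (imhAcceptMass q w x).toReal ∂π)
            * ((∫ x, (imhAcceptMass q w x).toReal ∂π) - ε.toReal) / ε.toReal) := by
  have hw : Measurable w := Fact.out
  have hε1 := eps_le_one_of_doeblin hmin
  have he0 : 0 < ε.toReal :=
    ENNReal.toReal_pos hε0.ne' (ne_top_of_le_ne_top ENNReal.one_ne_top hε1)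
  have hfl : ∀ x, ε.toReal ≤ (imhAcceptMass q w x).toReal := fun x =>
    ENNReal.toReal_mono (ne_top_of_le_ne_top ENNReal.one_ne_top (imhAcceptMass_le_one q w x))
      (hacc x)
  have h1 : ∀ x, (imhAcceptMass q w x).toReal ≤ 1 := fun x =>
    (le_abs_self _).trans (abs_toReal_imhAcceptMass_le x)
  have hBD := integral_sq_sub_le_of_mem_Icc π (measurable_toReal_imhAcceptMass (q := q) hw) hfl h1
  have henv := variance_sum_acceptFlag_le_of_doeblin hw0 hπ hmin hε0 N
  have hc : (0 : ℝ) ≤ 2 * N / ε.toReal := div_nonneg (by positivity) he0.le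
  have key := mul_le_mul_of_nonneg_left hBD hc
  have heq : 2 * N / ε.toReal * (((∫ x, (imhAcceptMass q w x).toReal ∂π) - ε.toReal)
        * (1 - ∫ x, (imhAcceptMass q w x).toReal ∂π))
      = 2 * N * ((1 - ∫ x, (imhAcceptMass q w x).toReal ∂π)
            * ((∫ x, (imhAcceptMass q w x).toReal ∂π) - ε.toReal) / ε.toReal) := by ring
  linarith

/-- **THE DISPERSION SANDWICH under a weight bound.**  If `0 < w ≤ M` (measurable) and
`π = w · q` is a probability law, then for the record chain started in `π̂` and every `N`:
`N ā(1 − ā) ≤ Var[Σ_{i<N} A_i] ≤ (1 + 2(M − 1/ā)) · N ā(1 − ā)` — the dispersion index of the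
acceptance count against `N` independent coin flips at the chain's own acceptance rate `ā` lies
in `[1, 1 + 2(M − 1/ā)]`, uniformly in `N` (and `ā ≥ 1/M`, so inside `[1, 2M − 1]`). -/
theorem variance_sum_acceptFlag_sandwich_of_le (hw0 : ∀ x, 0 < w x) {M : ℝ} (hM : ∀ x, w x ≤ M)
    (hπ : (q.withDensity fun x => ENNReal.ofReal (w x)) = π) (N : ℕ) :
    N * ((∫ x, (imhAcceptMass q w x).toReal ∂π) * (1 - ∫ x, (imhAcceptMass q w x).toReal ∂π))
        ≤ Var[fun x : ℕ → Ω × Bool => ∑ i ∈ range N, acceptFlag (x i); imhRecordPath q w π] ∧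
      Var[fun x : ℕ → Ω × Bool => ∑ i ∈ range N, acceptFlag (x i); imhRecordPath q w π]
        ≤ (1 + 2 * (M - 1 / ∫ x, (imhAcceptMass q w x).toReal ∂π))
          * (N * ((∫ x, (imhAcceptMass q w x).toReal ∂π)
            * (1 - ∫ x, (imhAcceptMass q w x).toReal ∂π))) := by
  have hw : Measurable w := Fact.out
  obtain ⟨x0⟩ := nonempty_of_isProbabilityMeasure π
  have hMpos : 0 < M := (hw0 x0).trans_le (hM x0)
  have hwi : Integrable w q :=
    integrable_of_bounded q hw (C := M) fun x => abs_le.2 ⟨by linarith [hw0 x], hM x⟩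
  have hmin : ∀ x {B : Set Ω}, MeasurableSet B → (ENNReal.ofReal M)⁻¹ * π B ≤ indepMH q w x B :=
    fun x B hB => by have h := indepMH_apply_ge (q := q) hw hw0 hM x hB; rwa [hπ] at h
  have hε0 : 0 < (ENNReal.ofReal M)⁻¹ := ENNReal.inv_pos.2 ENNReal.ofReal_ne_top
  have hacc := inv_le_imhAcceptMass_of_le hw hw0 hM hπ
  have he : ((ENNReal.ofReal M)⁻¹).toReal = 1 / M := by
    rw [ENNReal.toReal_inv, ENNReal.toReal_ofReal hMpos.le, one_div]
  have hIα : Integrable (fun x => (imhAcceptMass q w x).toReal) π :=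
    integrable_of_bounded π (measurable_toReal_imhAcceptMass (q := q) hw)
      abs_toReal_imhAcceptMass_le
  have hfl : ∀ x, 1 / M ≤ (imhAcceptMass q w x).toReal := fun x => by
    have h := ENNReal.toReal_mono
      (ne_top_of_le_ne_top ENNReal.one_ne_top (imhAcceptMass_le_one q w x)) (hacc x)
    rwa [he] at h
  have hā : 1 / M ≤ ∫ x, (imhAcceptMass q w x).toReal ∂π := by
    have h := integral_mono (integrable_const (1 / M)) hIα hfl
    rwa [integral_const, probReal_univ, one_smul] at h
  have hā0 : 0 < ∫ x, (imhAcceptMass q w x).toReal ∂π := lt_of_lt_of_le (by positivity) hā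
  refine ⟨variance_sum_acceptFlag_ge_binomial hw0 hwi hπ N, ?_⟩
  have h := variance_sum_acceptFlag_le_of_floor hw0 hπ hmin hε0 hacc N
  rw [he] at h
  have heq : (N : ℝ) * ((∫ x, (imhAcceptMass q w x).toReal ∂π)
          * (1 - ∫ x, (imhAcceptMass q w x).toReal ∂π))
        + 2 * N * ((1 - ∫ x, (imhAcceptMass q w x).toReal ∂π)
            * ((∫ x, (imhAcceptMass q w x).toReal ∂π) - 1 / M) / (1 / M))
      = (1 + 2 * (M - 1 / ∫ x, (imhAcceptMass q w x).toReal ∂π))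
          * (N * ((∫ x, (imhAcceptMass q w x).toReal ∂π)
            * (1 - ∫ x, (imhAcceptMass q w x).toReal ∂π))) := by
    field_simp
  exact h.trans heq.le

end Path

end General

/-! ### The lattice instance -/

section Lattice

open Literature.MathematicalPhysics.QuantumFieldTheory
open Literature.MathematicalPhysics.QuantumFieldTheory.Luscher2010
open Summit.Ventures.LatticeQCDFlow.TrivializingMaps
open scoped Matrix Matrix.Norms.Frobenius ContDiff

variable {d L n : ℕ} [NeZero L]

/-- **THE ACCEPTANCE RECORD OF AN EXACT FLOW SAMPLER: dispersion sandwich on the lattice.**  For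
an `SU(n)` gauge theory on the periodic lattice `(ℤ/L)^d` with smooth action `S`, an approximately
trivializing flow `Φ` generated by a smooth `F` with Lüscher defect `|L_t(F_t) − S − c t| ≤ δ` on
`[0, 1]`, and the flow sampler's model `q = (Φ 1)_* D[V]`: there is an importance weight `w`
(measurable, `w · q = 𝒵⁻¹e^{−S}D[U]`, the flow-MCMC kernel leaves the Boltzmann law invariant)
such that the chain accepts from every configuration with probability `≥ e^{−2δ}`, and the
acceptance count of the record chain started in stationarity satisfies, at EVERY volume and `N`,
`N ā(1 − ā) ≤ Var[Σ_{i<N} A_i] ≤ (1 + 2(e^{2δ} − 1/ā)) · N ā(1 − ā)`.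
(The two instance binders are supplied by `⟨hw⟩` and `isProbabilityMeasure_boltzmannMeasure`.) -/
theorem flowSampler_acceptRecord_sandwich (B : SuBasis n)
    {S : AmbConfig d L n → ℝ} (hS : ContDiff ℝ ∞ S) {F : ℝ → AmbConfig d L n → ℝ}
    (hF : ContDiff ℝ ∞ fun p : ℝ × AmbConfig d L n => F p.1 p.2)
    {Φ : ℝ → GaugeConfig d L (Matrix.specialUnitaryGroup (Fin n) ℂ) →
      GaugeConfig d L (Matrix.specialUnitaryGroup (Fin n) ℂ)}
    (hΦ : IsFlowMap (fun t W => -linkGrad B (F t) W) Φ) {c : ℝ → ℝ} {δ : ℝ}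
    (hδ : ∀ t ∈ Set.Icc (0 : ℝ) 1, ∀ U : GaugeConfig d L (Matrix.specialUnitaryGroup (Fin n) ℂ),
      |luscherL B S t (F t) (WilsonFlow.coeConfig U) - S (WilsonFlow.coeConfig U) - c t| ≤ δ)
    (q : Measure (GaugeConfig d L (Matrix.specialUnitaryGroup (Fin n) ℂ))) [IsProbabilityMeasure q]
    (hq : q = Measure.map (Φ 1) (trivialMeasure (Matrix.specialUnitaryGroup (Fin n) ℂ) d L)) :
    ∃ w : GaugeConfig d L (Matrix.specialUnitaryGroup (Fin n) ℂ) → ℝ, Measurable w ∧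
      (q.withDensity fun U => ENNReal.ofReal (w U)) =
        boltzmannMeasure (fun U : GaugeConfig d L (Matrix.specialUnitaryGroup (Fin n) ℂ) =>
          S (WilsonFlow.coeConfig U)) ∧
      Kernel.Invariant (indepMH q w)
        (boltzmannMeasure fun U : GaugeConfig d L (Matrix.specialUnitaryGroup (Fin n) ℂ) =>
          S (WilsonFlow.coeConfig U)) ∧
      (∀ U, Real.exp (-(2 * δ)) ≤ (imhAcceptMass q w U).toReal) ∧
      ∀ [Fact (Measurable w)]
        [IsProbabilityMeasure (boltzmannMeasure fun U :
          GaugeConfig d L (Matrix.specialUnitaryGroup (Fin n) ℂ) => S (WilsonFlow.coeConfig U))]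
        (N : ℕ),
        (N : ℝ) * ((∫ U, (imhAcceptMass q w U).toReal ∂(boltzmannMeasure fun U :
                GaugeConfig d L (Matrix.specialUnitaryGroup (Fin n) ℂ) =>
                  S (WilsonFlow.coeConfig U)))
            * (1 - ∫ U, (imhAcceptMass q w U).toReal ∂(boltzmannMeasure fun U :
                GaugeConfig d L (Matrix.specialUnitaryGroup (Fin n) ℂ) =>
                  S (WilsonFlow.coeConfig U))))
          ≤ Var[fun x : ℕ → GaugeConfig d L (Matrix.specialUnitaryGroup (Fin n) ℂ) × Bool =>
              ∑ i ∈ range N, acceptFlag (x i);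
            imhRecordPath q w (boltzmannMeasure fun U :
              GaugeConfig d L (Matrix.specialUnitaryGroup (Fin n) ℂ) =>
                S (WilsonFlow.coeConfig U))] ∧
        Var[fun x : ℕ → GaugeConfig d L (Matrix.specialUnitaryGroup (Fin n) ℂ) × Bool =>
              ∑ i ∈ range N, acceptFlag (x i);
            imhRecordPath q w (boltzmannMeasure fun U :
              GaugeConfig d L (Matrix.specialUnitaryGroup (Fin n) ℂ) =>
                S (WilsonFlow.coeConfig U))]
          ≤ (1 + 2 * (Real.exp (2 * δ) - 1 / ∫ U, (imhAcceptMass q w U).toReal ∂(boltzmannMeasure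
              fun U : GaugeConfig d L (Matrix.specialUnitaryGroup (Fin n) ℂ) =>
                S (WilsonFlow.coeConfig U))))
            * (N * ((∫ U, (imhAcceptMass q w U).toReal ∂(boltzmannMeasure fun U :
                  GaugeConfig d L (Matrix.specialUnitaryGroup (Fin n) ℂ) =>
                    S (WilsonFlow.coeConfig U)))
              * (1 - ∫ U, (imhAcceptMass q w U).toReal ∂(boltzmannMeasure fun U :
                  GaugeConfig d L (Matrix.specialUnitaryGroup (Fin n) ℂ) =>
                    S (WilsonFlow.coeConfig U))))) := by
  obtain ⟨w, hw, hlo, hhi, hπ, hinv, hacc, -⟩ := flowSampler_exact_doeblin B hS hF hΦ hδ q hq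
  refine ⟨w, hw, hπ, hinv, fun U => ?_, ?_⟩
  · have h := ENNReal.toReal_mono
      (ne_top_of_le_ne_top ENNReal.one_ne_top (imhAcceptMass_le_one q w U)) (hacc U)
    rwa [ENNReal.toReal_ofReal (Real.exp_pos _).le] at h
  · intro hFw hP N
    exact variance_sum_acceptFlag_sandwich_of_le (fun U => (Real.exp_pos _).trans_le (hlo U))
      hhi hπ N

end Lattice

end Summit.Ventures.LatticeQCDFlow.Scoring
end
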